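import Summits.QuantumFields.BalabanUV.Beta.GAN24.CapacitanceScalarRateTerm
import Literature.NumberTheory.QuadraticFields.ReducedFormLatticeSum

/-!
# `BalabanUV.Beta.GAN24.CapacitanceScalarRateBox` — binder row G-an2-4 / (CONV-C), road P1-fibre, leaf **P1-Y11s** of
# `GAN24/Formal/LEAVES.md` v2.1 — PART 3 of 4: the scalars `ã_κ^{(N)}`, `σ̃^{(N)}` over `(ℤ/N)^D`, their alias-box form, and the
# `N`-uniform continuum alias-sum bounds (R2)

NOT IN PRINT; OUR PROOF ATTEMPT.  HONEST FRAMING (cell contract, verbatim): «discharging `BetaPertH` makes Bałaban's UV stability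
UNCONDITIONAL — a real constructive-QFT result; it is NOT the continuum limit and NOT the Clay problem.»  HONEST DEPENDENCY (verbatim):
«continuum YM on T⁴ ⇐ BetaPertH ∧ nine spine estimates (0/9 proved); BetaPertH ⇐ (D1) ∧ (D4) ∧ CAP+tail; G-an2-4 gates asym, D1 and
NE2/3/4.»  [folklore] real analysis (geometric sums, Jordan, `sin` Taylor bounds, finite alias sums); 0 cite, 0 wall binder, no
`def … : Prop`; it discharges NOTHING of (CONV-C)'s K-slot `GAN24.CombesThomas.ConvCK 3 Lc` by itself — it is the Part-B (rate `θ = Lc⁻²`)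
bookkeeping for the two SCALAR alias sums `a_κ(p)`, `σ(p)` of the capacitance matrix `Cap = [[diag(a) − (σ/2)δδ♭ᵀ, σδ],[σδ♭ᵀ, 0]]`
(leaf-02-g4's structure theorem, `GAN24/CapacitanceClosedForm`), consumed by gan24-p1's row P1-L11 `FibreRate` together with rows Y08s/E4 of
`GAN24/Formal/LEAVES.md` v2.1.  NOT `BetaPertH`, NOT continuum, NOT Clay.  Value = kernel bookkeeping leaf toward the K-slot route P1 of binder
row G-an2-4, NOT summit progress.

## The leaf (P1-Y11s = self-row «L11b*», SKELETON-P1 node N17 `blockwise_rate` restricted to the capacitance scalars) in four parts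
1. `GAN24/CapacitanceScalarRate` — the normalised one-coordinate alias weight `aw N x = ‖Σ_{t<N} e^{ixt}‖²/N²`, its continuum reference
   `awInf q = sinc²(q/2)`, the scaled symbol `symN N q = Σ_i N²·4 sin²(q_i/(2N))`, their RELATIVE second-order comparisons on the scaled
   Brillouin zone (R1), and the product engine `mul_rel` / `prod_rel`;
2. `GAN24/CapacitanceScalarRateTerm` — the summands `fA`, `fS` of `ã_κ = a_κ/N^{D+4}`, `σ̃ = σ/N^{D+4}` versus their continuum references
   (`fA_rel`, `fS_rel`: relative rate `(π²/16)(|q|²/N²)·Kc D`), and the ALIAS WINDOWS (`zrep`, integer alias box `boxZ`, nesting in `N`);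
3. `GAN24/CapacitanceScalarRateBox` — `aT N p κ = ã_κ^{(N)}(p)`, `sT N p = σ̃^{(N)}(p)` as sums over `(ℤ/N)^D` in leaf P1-L06's `kfine`
   currency, their alias-box form, and the `N`-uniform continuum alias-sum bounds (R2) `Σ_box Π_i sinc² ≤ 3^D`;
4. `GAN24/CapacitanceScalarRateSum` — (R3) tails and (R4) the TWO-SCALE RATES `aT_rate : |ã_κ^{(N')}(p) − ã_κ^{(N)}(p)| ≤ rateA D/N²`,
   `sT_rate : |σ̃^{(N')} − σ̃^{(N)}| ≤ rateS D·(1 + |p|⁻²)/N²` for all `1 ≤ N ≤ N'`, `p ∈ [−π, π]^D ∖ {0}`.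

## What is proved in this part
* §5 **`aT N p κ`** `= Σ_{m ∈ (ℤ/N)^D} (Π_i aw N k_{m,i})·aw N k_{m,κ}/(2N²·lapR k_m)` and **`sT N p`** `= Σ_m (Π_i aw N k_{m,i})/(N²·lapR k_m)²`,
  `k_m = kfine N p m` (leaf P1-L06's currency; `a_κ(p) = N^{D+4}·aT`, `σ(p) = N^{D+4}·sT` for leaf-02/leaf-12's `a_κ`, `σ`), the
  periodicity lemmas `aw_add_int`, `lapR_add_int`, `kfine_eq_qv_add`, and the ALIAS-BOX FORM `aT_eq_sum_boxZ` / `sT_eq_sum_boxZ`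
  (`aT N p κ = Σ_{z ∈ boxZ N p} fA N κ (p + 2πz)`);
* §6 (R2) `sum_inv_intSq_le_four` (via the tree's `sum_inv_natCast_sq_le_two` / Mathlib `sum_Ioo_inv_sq_le`), `awInf_shift_le` (`sinc²((s+2πz)/2) ≤ 1/(2z²)`,
  `z ≠ 0`), **`sum_awInf_zrep_le`** (`Σ_{r ∈ ℤ/M} sinc²((s + 2π·zrep r)/2) ≤ 3`) and **`sum_boxZ_pwInf_le`** (`Σ_{z ∈ boxZ M p} Π_i sinc²(q_i/2) ≤ 3^D`),
  uniformly in `M`.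

Unit `b2b-balaban-gan24-formalise-leaf-07` (G-an2-4 formalisation swarm, leaf prover 07, gen 5), 2026-08-19.
-/

noncomputable section

open Complex Finset
open scoped BigOperators Real

namespace Summit.QuantumFields.BalabanUV.Beta.GAN24.CapacitanceScalarRateBox

open AliasWeights AliasWeightsSum SymbolTaylor CapacitanceScalarRate CapacitanceScalarRateTerm
open Literature.MathematicalPhysics.QuantumFieldTheory.King1986 (momSq momSq_nonneg)
-- the landed [folklore] `Σ_{n ∈ S} 1/n² ≤ 2` (positive naturals) is REUSED BY NAME (gate dedup rule), not restated:
open Literature.NumberTheory.QuadraticFields.BinaryQuadraticForm (sum_inv_natCast_sq_le_two)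

variable {D : ℕ}

/-! ## §5 The two capacitance scalars in units `N^{−(D+4)}` over `(ℤ/N)^D`, and their alias-box form -/

/-- [folklore] `aw N` is `2π`-periodic. -/
theorem aw_add_int (N : ℕ) (x : ℝ) (k : ℤ) : aw N (x + 2 * π * k) = aw N x := by
  have hsum : ∑ t ∈ Finset.range N, cexp (I * ((x + 2 * π * (k : ℝ) : ℝ) : ℂ) * (t : ℂ))
      = ∑ t ∈ Finset.range N, cexp (I * (x : ℂ) * (t : ℂ)) := by
    refine Finset.sum_congr rfl fun t _ => ?_
    have : I * ((x + 2 * π * (k : ℝ) : ℝ) : ℂ) * (t : ℂ) = I * (x : ℂ) * t + ((k * t : ℤ) : ℂ) * (2 * π * I) := by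
      push_cast; ring
    rw [this, Complex.exp_add, Complex.exp_int_mul_two_pi_mul_I, mul_one]
  unfold aw
  rw [hsum]

/-- [folklore] `lapR` is `2π`-periodic in every coordinate. -/
theorem lapR_add_int (x : Fin D → ℝ) (k : Fin D → ℤ) : lapR (fun i => x i + 2 * π * (k i : ℝ)) = lapR x := by
  unfold lapR
  refine Finset.sum_congr rfl fun i _ => ?_
  have : (x i + 2 * π * (k i : ℝ)) / 2 = x i / 2 + (k i : ℤ) * π := by ring
  have h1 : ((-1 : ℝ) ^ (k i)) ^ 2 = 1 := by rw [← sq_abs, abs_neg_one_zpow, one_pow]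
  rw [this, Real.sin_add_int_mul_pi, mul_pow, h1, one_mul]

/-- [folklore] `kfine` and the zone representative differ by a multiple of `2π`:
`kfine N p m i = (p_i + 2π·zrep)/N + 2πk` for some integer `k`. -/
theorem kfine_eq_qv_add {N : ℕ} [NeZero N] (p : Fin D → ℝ) (m : Fin D → ZMod N) (i : Fin D) :
    ∃ k : ℤ, kfine N p m i = qv p (zvec N p m) i / N + 2 * π * k := by
  have hN : (N : ℝ) ≠ 0 := by exact_mod_cast NeZero.ne N
  have hdvd : (N : ℤ) ∣ (((m i).val : ℤ) - zrep N (p i) (m i)) := by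
    rw [← ZMod.intCast_zmod_eq_zero_iff_dvd, Int.cast_sub, zrep_cast, Int.cast_natCast, ZMod.natCast_zmod_val,
      sub_self]
  obtain ⟨k, hk⟩ := hdvd
  refine ⟨k, ?_⟩
  have hkR : (((m i).val : ℕ) : ℝ) = (zrep N (p i) (m i) : ℝ) + (N : ℝ) * k := by
    have := congrArg (fun z : ℤ => (z : ℝ)) hk
    push_cast at this
    linarith
  unfold kfine qv zvec
  rw [hkR]
  field_simp
  ring

/-- **`ã_κ^{(N)}(p)`** — the `a_κ` ALIAS SUM of the capacitance matrix in units `N^{−(D+4)}`, in leaf P1-L06's currency: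
`aT N p κ = Σ_{m ∈ (ℤ/N)^D} (Π_i aw N k_{m,i})·aw N k_{m,κ} / (2·N²·lapR k_m)`, `k_m = kfine N p m`
(`a_κ(p) = Σ_m w_m|s_κ(m)|²/(2L_m) = N^{D+4}·aT N p κ` with `w_m = |S(m)|²/N^D`). -/
def aT (N : ℕ) [NeZero N] (p : Fin D → ℝ) (κ : Fin D) : ℝ :=
  ∑ m : Fin D → ZMod N, (∏ i, aw N (kfine N p m i)) * aw N (kfine N p m κ) / (2 * ((N : ℝ) ^ 2 * lapR (kfine N p m)))

/-- **`σ̃^{(N)}(p)`** — the `σ` ALIAS SUM in units `N^{−(D+4)}`: `sT N p = Σ_m (Π_i aw N k_{m,i}) / (N²·lapR k_m)²`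
(`σ(p) = Σ_m w_m/L_m² = N^{D+4}·sT N p`). -/
def sT (N : ℕ) [NeZero N] (p : Fin D → ℝ) : ℝ :=
  ∑ m : Fin D → ZMod N, (∏ i, aw N (kfine N p m i)) / ((N : ℝ) ^ 2 * lapR (kfine N p m)) ^ 2

/-- [folklore] The summand dictionary: at `m ∈ (ℤ/N)^D` the `kfine`-summand is `fA` at the zone alias momentum. -/
theorem summand_eq_fA {N : ℕ} [NeZero N] (p : Fin D → ℝ) (κ : Fin D) (m : Fin D → ZMod N) :
    (∏ i, aw N (kfine N p m i)) * aw N (kfine N p m κ) / (2 * ((N : ℝ) ^ 2 * lapR (kfine N p m)))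
      = fA N κ (qv p (zvec N p m)) := by
  choose k hk using fun i => kfine_eq_qv_add p m i
  have hkf : kfine N p m = fun i => qv p (zvec N p m) i / N + 2 * π * (k i : ℝ) := funext hk
  unfold fA pw
  rw [symN_eq_sq_mul_lapR, hkf, lapR_add_int]
  simp only [aw_add_int]

/-- [folklore] The summand dictionary for `σ̃`: the `kfine`-summand is `fS` at the zone alias momentum. -/
theorem summand_eq_fS {N : ℕ} [NeZero N] (p : Fin D → ℝ) (m : Fin D → ZMod N) :
    (∏ i, aw N (kfine N p m i)) / ((N : ℝ) ^ 2 * lapR (kfine N p m)) ^ 2 = fS N (qv p (zvec N p m)) := by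
  choose k hk using fun i => kfine_eq_qv_add p m i
  have hkf : kfine N p m = fun i => qv p (zvec N p m) i / N + 2 * π * (k i : ℝ) := funext hk
  unfold fS pw
  rw [symN_eq_sq_mul_lapR, hkf, lapR_add_int]
  simp only [aw_add_int]

/-- [folklore] **Alias-box form**: `aT N p κ = Σ_{z ∈ boxZ N p} fA N κ (p + 2πz)`. -/
theorem aT_eq_sum_boxZ {N : ℕ} [NeZero N] (p : Fin D → ℝ) (κ : Fin D) :
    aT N p κ = ∑ z ∈ boxZ N p, fA N κ (qv p z) := by
  rw [sum_boxZ]; unfold aT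
  exact Finset.sum_congr rfl fun m _ => summand_eq_fA p κ m

/-- [folklore] **Alias-box form**: `sT N p = Σ_{z ∈ boxZ N p} fS N (p + 2πz)`. -/
theorem sT_eq_sum_boxZ {N : ℕ} [NeZero N] (p : Fin D → ℝ) : sT N p = ∑ z ∈ boxZ N p, fS N (qv p z) := by
  rw [sum_boxZ]; unfold sT
  exact Finset.sum_congr rfl fun m _ => summand_eq_fS p m

/-! ## §6 Uniform bounds for the continuum-weighted alias sums -/

/-- [folklore] `Σ_{z ∈ W, z ≠ 0} 1/z² ≤ 4` for every finite set of integers. -/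
theorem sum_inv_intSq_le_four (W : Finset ℤ) : ∑ z ∈ W.filter (fun z => z ≠ 0), ((z : ℝ) ^ 2)⁻¹ ≤ 4 := by
  classical
  have hsplit : W.filter (fun z => z ≠ 0) = W.filter (fun z => 0 < z) ∪ W.filter (fun z => z < 0) := by
    ext z
    simp only [Finset.mem_filter, Finset.mem_union]
    constructor
    · rintro ⟨hW, hz⟩
      rcases lt_or_gt_of_ne hz with h | h
      · exact Or.inr ⟨hW, h⟩
      · exact Or.inl ⟨hW, h⟩
    · rintro (⟨hW, h⟩ | ⟨hW, h⟩) <;> exact ⟨hW, by omega⟩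
  have hdisj : Disjoint (W.filter fun z => 0 < z) (W.filter fun z => z < 0) :=
    Finset.disjoint_filter.2 fun z _ h1 h2 => by omega
  rw [hsplit, Finset.sum_union hdisj]
  -- positive part via `Int.toNat`, negative part via `z ↦ (-z).toNat`
  have hpos : ∑ z ∈ W.filter (fun z => 0 < z), ((z : ℝ) ^ 2)⁻¹ ≤ 2 := by
    have hinj : Set.InjOn Int.toNat ↑(W.filter fun z => 0 < z) := by
      intro a ha b hb h
      have ha' : 0 < a := (Finset.mem_filter.1 (Finset.mem_coe.1 ha)).2
      have hb' : 0 < b := (Finset.mem_filter.1 (Finset.mem_coe.1 hb)).2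
      have h1 : ((Int.toNat a : ℕ) : ℤ) = a := Int.toNat_of_nonneg ha'.le
      have h2 : ((Int.toNat b : ℕ) : ℤ) = b := Int.toNat_of_nonneg hb'.le
      have h3 : ((Int.toNat a : ℕ) : ℤ) = ((Int.toNat b : ℕ) : ℤ) := by
        have h' : Int.toNat a = Int.toNat b := h
        rw [h']
      omega
    have hcongr : ∑ z ∈ W.filter (fun z => 0 < z), ((z : ℝ) ^ 2)⁻¹
        = ∑ z ∈ W.filter (fun z => 0 < z), ((((Int.toNat z : ℕ) : ℝ)) ^ 2)⁻¹ := by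
      refine Finset.sum_congr rfl fun z hz => ?_
      have hz0 : 0 ≤ z := (Finset.mem_filter.1 hz).2.le
      have : ((Int.toNat z : ℕ) : ℝ) = (z : ℝ) := by exact_mod_cast Int.toNat_of_nonneg hz0
      rw [this]
    rw [hcongr, ← Finset.sum_image (f := fun n : ℕ => ((n : ℝ) ^ 2)⁻¹) hinj]
    refine sum_inv_natCast_sq_le_two _ fun h => ?_
    obtain ⟨z, hz, hz0⟩ := Finset.mem_image.1 h
    have := (Finset.mem_filter.1 hz).2
    omega
  have hneg : ∑ z ∈ W.filter (fun z => z < 0), ((z : ℝ) ^ 2)⁻¹ ≤ 2 := by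
    have hinj : Set.InjOn (fun z : ℤ => Int.toNat (-z)) ↑(W.filter fun z => z < 0) := by
      intro a ha b hb h
      have ha' : a < 0 := (Finset.mem_filter.1 (Finset.mem_coe.1 ha)).2
      have hb' : b < 0 := (Finset.mem_filter.1 (Finset.mem_coe.1 hb)).2
      have h1 : ((Int.toNat (-a) : ℕ) : ℤ) = -a := Int.toNat_of_nonneg (by omega)
      have h2 : ((Int.toNat (-b) : ℕ) : ℤ) = -b := Int.toNat_of_nonneg (by omega)
      have h3 : ((Int.toNat (-a) : ℕ) : ℤ) = ((Int.toNat (-b) : ℕ) : ℤ) := by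
        have h' : Int.toNat (-a) = Int.toNat (-b) := h
        rw [h']
      omega
    have hcongr : ∑ z ∈ W.filter (fun z => z < 0), ((z : ℝ) ^ 2)⁻¹
        = ∑ z ∈ W.filter (fun z => z < 0), ((((Int.toNat (-z) : ℕ) : ℝ)) ^ 2)⁻¹ := by
      refine Finset.sum_congr rfl fun z hz => ?_
      have hz0 : 0 ≤ -z := by have := (Finset.mem_filter.1 hz).2; omega
      have : ((Int.toNat (-z) : ℕ) : ℝ) = -(z : ℝ) := by exact_mod_cast Int.toNat_of_nonneg hz0
      rw [this, neg_sq]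
    rw [hcongr, ← Finset.sum_image (f := fun n : ℕ => ((n : ℝ) ^ 2)⁻¹) hinj]
    refine sum_inv_natCast_sq_le_two _ fun h => ?_
    obtain ⟨z, hz, hz0⟩ := Finset.mem_image.1 h
    have := (Finset.mem_filter.1 hz).2
    have hz0' : Int.toNat (-z) = 0 := hz0
    omega
  linarith

/-- [folklore] A nonzero integer shift moves a zone momentum far out: `π|z| ≤ |s + 2πz|` (`|s| ≤ π`, `z ≠ 0`). -/
theorem pi_mul_abs_le {s : ℝ} (hs : |s| ≤ π) {z : ℤ} (hz : z ≠ 0) : π * |(z : ℝ)| ≤ |s + 2 * π * (z : ℝ)| := by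
  have hπ := Real.pi_pos
  have hs1 := (abs_le.1 hs).1
  have hs2 := (abs_le.1 hs).2
  rcases lt_or_gt_of_ne hz with h | h
  · have h' : (z : ℝ) ≤ -1 := by exact_mod_cast Int.le_sub_one_of_lt h
    rw [abs_of_neg (by linarith : (z : ℝ) < 0), abs_of_nonpos (by nlinarith)]
    nlinarith
  · have h' : (1 : ℝ) ≤ z := by exact_mod_cast h
    rw [abs_of_pos (by linarith : (0 : ℝ) < z), abs_of_nonneg (by nlinarith)]
    nlinarith

/-- [folklore] Hence the continuum weight of a nonzero shift is `≤ 1/(2z²)` (`π² ≥ 8`). -/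
theorem awInf_shift_le {s : ℝ} (hs : |s| ≤ π) {z : ℤ} (hz : z ≠ 0) :
    awInf (s + 2 * π * (z : ℝ)) ≤ 1 / 2 * ((z : ℝ) ^ 2)⁻¹ := by
  have hπ := Real.pi_gt_three
  have hz1 : (1 : ℝ) ≤ |(z : ℝ)| := by
    rw [← Int.cast_abs]; exact_mod_cast Int.one_le_abs hz
  have hq := pi_mul_abs_le hs hz
  have hq0 : s + 2 * π * (z : ℝ) ≠ 0 := by
    intro h; rw [h, abs_zero] at hq; nlinarith
  have h4 := awInf_le_div_sq hq0
  have hzz : 0 < (z : ℝ) ^ 2 := by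
    have : (z : ℝ) ≠ 0 := by exact_mod_cast hz
    positivity
  calc awInf (s + 2 * π * (z : ℝ)) ≤ 4 / (s + 2 * π * (z : ℝ)) ^ 2 := h4
    _ ≤ 4 / (8 * (z : ℝ) ^ 2) := by
        apply div_le_div_of_nonneg_left (by norm_num) (by positivity)
        have hπ2 : (8 : ℝ) ≤ π ^ 2 := by nlinarith
        calc 8 * (z : ℝ) ^ 2 ≤ (π * |(z : ℝ)|) ^ 2 := by
              rw [mul_pow, sq_abs]; exact mul_le_mul_of_nonneg_right hπ2 hzz.le
          _ ≤ (s + 2 * π * (z : ℝ)) ^ 2 := by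
              rw [← sq_abs (s + _)]; exact pow_le_pow_left₀ (by positivity) hq 2
    _ = 1 / 2 * ((z : ℝ) ^ 2)⁻¹ := by field_simp; ring

/-- [folklore] **One-coordinate continuum alias sum**: `Σ_{r ∈ ℤ/M} sinc²((s + 2π·zrep r)/2) ≤ 3`, uniformly in `M`
(`|s| ≤ π`): the zero shift contributes `≤ 1`, the others `≤ Σ_{z ≠ 0} 1/(2z²) ≤ 2`. -/
theorem sum_awInf_zrep_le {M : ℕ} [NeZero M] {s : ℝ} (hs : |s| ≤ π) :
    ∑ r : ZMod M, awInf (s + 2 * π * (zrep M s r : ℝ)) ≤ 3 := by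
  classical
  have hinj : Set.InjOn (zrep M s) ↑(Finset.univ : Finset (ZMod M)) := fun a _ b _ h => by
    simpa [zrep_cast] using congrArg (fun z : ℤ => (z : ZMod M)) h
  rw [← Finset.sum_image (f := fun z : ℤ => awInf (s + 2 * π * (z : ℝ))) hinj]
  set W := (Finset.univ : Finset (ZMod M)).image (zrep M s)
  rw [← Finset.sum_filter_add_sum_filter_not W (fun z => z = 0)]
  have h1 : ∑ z ∈ W.filter (fun z => z = 0), awInf (s + 2 * π * (z : ℝ)) ≤ 1 := by
    rw [Finset.filter_eq' W 0]
    split_ifs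
    · simpa using awInf_le_one s
    · simp
  have h2 : ∑ z ∈ W.filter (fun z => ¬z = 0), awInf (s + 2 * π * (z : ℝ)) ≤ 2 := by
    calc ∑ z ∈ W.filter (fun z => ¬z = 0), awInf (s + 2 * π * (z : ℝ))
        ≤ ∑ z ∈ W.filter (fun z => ¬z = 0), 1 / 2 * ((z : ℝ) ^ 2)⁻¹ :=
          Finset.sum_le_sum fun z hz => awInf_shift_le hs (Finset.mem_filter.1 hz).2
      _ = 1 / 2 * ∑ z ∈ W.filter (fun z => z ≠ 0), ((z : ℝ) ^ 2)⁻¹ := by rw [Finset.mul_sum]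
      _ ≤ 1 / 2 * 4 := mul_le_mul_of_nonneg_left (sum_inv_intSq_le_four W) (by norm_num)
      _ = 2 := by norm_num
  linarith

/-- [folklore] **`D`-dimensional continuum alias sum over the box**: `Σ_{z ∈ boxZ M p} Π_i sinc²(q_i/2) ≤ 3^D`, all `M`. -/
theorem sum_boxZ_pwInf_le {M : ℕ} [NeZero M] {p : Fin D → ℝ} (hp : ∀ i, |p i| ≤ π) :
    ∑ z ∈ boxZ M p, pwInf (qv p z) ≤ (3 : ℝ) ^ D := by
  rw [sum_boxZ]
  have h : ∀ m : Fin D → ZMod M, pwInf (qv p (zvec M p m)) = ∏ i, awInf (p i + 2 * π * (zrep M (p i) (m i) : ℝ)) :=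
    fun m => rfl
  simp_rw [h]
  rw [← Fintype.prod_sum (fun i (r : ZMod M) => awInf (p i + 2 * π * (zrep M (p i) r : ℝ)))]
  calc ∏ i, ∑ r : ZMod M, awInf (p i + 2 * π * (zrep M (p i) r : ℝ)) ≤ ∏ _i : Fin D, (3 : ℝ) :=
        Finset.prod_le_prod (fun i _ => Finset.sum_nonneg fun r _ => awInf_nonneg _) fun i _ => sum_awInf_zrep_le (hp i)
    _ = (3 : ℝ) ^ D := by rw [Finset.prod_const, Finset.card_univ, Fintype.card_fin]

end Summit.QuantumFields.BalabanUV.Beta.GAN24.CapacitanceScalarRateBox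

end
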